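import Mathlib
import HarnessLib
import Literature.MathematicalPhysics.QuantumLattice.GaugeGroups
import Literature.MathematicalPhysics.QuantumFieldTheory.ConstructiveQFTWave0
import Literature.MathematicalPhysics.QuantumFieldTheory.U1GinibreComparison
import Summits.Ventures.LatticeQCDFlow.Scaling.Conjectures
import Summits.Ventures.LatticeQCDFlow.Scaling.ConjecturesRepaired
import Summits.Ventures.LatticeQCDFlow.Scaling.ExactTransportDepth
import Summits.Ventures.LatticeQCDFlow.Scaling.ExactTransportVolumeR
import Summits.Ventures.LatticeQCDFlow.Scaling.LatticeEntropyU1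

/-!
# LatticeQCDFlow / Scaling — the layer-depth law REPAIRED (`L ≥ 2`), and its `U(1)` instance

HONEST FRAMING: exact (Metropolis-corrected) sampling algorithms for lattice gauge theory; figures
of merit are autocorrelation/cost numbers at stated couplings and volumes; no continuum-physics
claim.

Venture `LatticeQCDFlow` (cell pub-lqcd), topic `Scaling`, FANOUT row 30 (lean-1 GEN-3) — OUR WORK.
`Scaling/ExactTransportDepth.lean` (theory2, v2.5) derives the LAYER-DEPTH LAW — an exact flow that is
a stack of `n` layers of per-layer bi-Lipschitz distortion `Λ·Λ'` has `c·β ≤ n·log(Λ·Λ')`, `c`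
independent of the volume — from the UNREPAIRED transport item (C2a)
`Conjectures.ExactTransportBiLipschitz`, which quantifies over every volume `L ≥ 1` and is therefore
FALSE for an abelian gauge group (at `L = 1` the abelian Wilson action vanishes identically and the
identity map is an exact transport, `Scaling/ExactTransportDegenerate.lean`); so that file has
instances only for `U(N)`, `SU(N)`, `N ≥ 2`.  The case the cell's STEP-0 numerics actually run —
compact `U(1)` in `d = 2` — is covered by the REPAIRED item (C2a-R)
`Conjectures.ExactTransportBiLipschitzR` (volumes `L ≥ 2`, guards `2 ≤ d`, `Infinite G`, non-constant
character), a THEOREM for `U(1)` (`U1.exactTransportBiLipschitzR`, `Scaling/ExactTransportVolumeR.lean`,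
row 30) as well as for `U(N)`, `SU(N)`, `N ≥ 2`.  This file:

* `LayerDepthLawR d N G ρ` — the layer-depth law with the same guards and the volume quantifier
  `∀ L ≥ 2` (a conjecture item exactly where (C2a-R) is one: general compact `G`);
* `layerDepthLawR_of_exactTransportR : ExactTransportBiLipschitzR → LayerDepthLawR` (same `c`, `β₀`),
  `layerDepthLawR_of_layerDepthLaw : LayerDepthLaw → LayerDepthLawR` (drop `L = 1`),
  `exp_le_prod_distortion_of_exactTransportR` (heterogeneous stacks: `∏ᵢ Λᵢ·Λ'ᵢ ≥ e^{cβ}`),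
  `no_exact_stack_of_distortion_le_one_R` (per-layer distortion `≤ 1` ⇒ no exact flow at `β > 0`);
* UNCONDITIONAL, GUARD-FREE `U(1)` STATEMENTS (`d ≥ 2`, `L ≥ 2`; `d = 2` is the STEP-0 system):
  `exists_re_trace_u1Rep_ne` (the circle is infinite by `Circle.argEquiv`, as in the tree's
  `Literature.Topology.FourManifolds.infinite_circle`, inlined), and
  **`U1.layerDepth (hd : 2 ≤ d) : ∃ c > 0, ∃ β₀, ∀ L ≥ 2, ∀ β ≥ β₀, ∀ stack … exact ⇒ c·β ≤ n·log(Λ·Λ')`**,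
  `U1.exp_le_prod_distortion`, `U1.no_exact_stack_of_distortion_le_one`: the depth of an exact `U(1)`
  flow of bounded per-layer distortion grows at least linearly in `β`, uniformly in the volume.

A statement about EXACT flows (model law = target); `ε`-accurate flows are conjecture C2b
(THEORY-2.md §3.3), untouched.  Elementary; nothing is cited as a fact.
-/

noncomputable section

open MeasureTheory Literature.MathematicalPhysics.QuantumFieldTheory

namespace Summit.Ventures.LatticeQCDFlow.Theory2.Lattice

/-! ## §1. The repaired layer-depth law -/

section LawR

variable (d N : ℕ) (G : Type) [Group G] [MetricSpace G] [IsTopologicalGroup G] [CompactSpace G]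
  [MeasurableSpace G] [BorelSpace G] (ρ : G →* Matrix (Fin N) (Fin N) ℂ)

/-- **Layer-depth law, REPAIRED (volumes `L ≥ 2`, guards as in (C2a-R)).**  For `2 ≤ d`, an infinite
gauge group and a non-constant character: there are `c > 0` and `β₀` such that at every volume
`L ≥ 2` and coupling `β ≥ β₀`, if a stack of `n` layers, each `Λ`-Lipschitz and `Λ'`-antilipschitz
for the sup metric, transports the product Haar measure EXACTLY onto the Wilson measure, then
`c·β ≤ n · log(Λ·Λ')`.  A conjecture item exactly where (C2a-R) is one (general compact `G`); a
THEOREM for `U(1)`, `U(N)`, `SU(N)` (`N ≥ 2`), `d ≥ 2` (§2). [ours] -/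
@[conjecture]
def LayerDepthLawR : Prop :=
  2 ≤ d → Infinite G → (∃ g : G, (ρ g).trace.re ≠ N) →
  ∃ c : ℝ, 0 < c ∧ ∃ β₀ : ℝ, ∀ (L : ℕ) [NeZero L], 2 ≤ L → ∀ β : ℝ, β₀ ≤ β →
    ∀ (l : List (GaugeConfig d L G → GaugeConfig d L G)) (Λ Λ' : NNReal),
      (∀ T ∈ l, LipschitzWith Λ T) → (∀ T ∈ l, AntilipschitzWith Λ' T) →
      (Measure.pi fun _ : Edge d L => haarProbability G).map (compLayers l) =
          wilsonMeasure (d := d) (L := L) ρ β →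
      c * β ≤ (l.length : ℝ) * Real.log ((Λ : ℝ) * Λ')

variable {d N G ρ}

/-- **(C2a-R) ⇒ the repaired layer-depth law** (same constants `c`, `β₀`): apply transport rigidity to
the composite, whose bi-Lipschitz constants are `Λⁿ`, `Λ'ⁿ`, and take logarithms. [ours] -/
theorem layerDepthLawR_of_exactTransportR (h : Conjectures.ExactTransportBiLipschitzR d N G ρ) :
    LayerDepthLawR d N G ρ := by
  intro hd hG hρ
  obtain ⟨c, hc, β₀, hβ⟩ := h hd hG hρ
  refine ⟨c, hc, β₀, fun L _ hL β hβ₀ l Λ Λ' hΛ hΛ' hT => ?_⟩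
  have h1 := hβ L hL β hβ₀ (compLayers l) (Λ ^ l.length) (Λ' ^ l.length)
    (lipschitzWith_compLayers l hΛ) (antilipschitzWith_compLayers l hΛ') hT
  rw [NNReal.coe_pow, NNReal.coe_pow, ← mul_pow] at h1
  have h2 := Real.log_le_log (Real.exp_pos _) h1
  rwa [Real.log_exp, Real.log_pow] at h2

/-- The unrepaired layer-depth law implies the repaired one (drop the volumes `L = 1` and the guards).
[ours] -/
theorem layerDepthLawR_of_layerDepthLaw (h : LayerDepthLaw d N G ρ) : LayerDepthLawR d N G ρ := by
  intro _ _ _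
  obtain ⟨c, hc, β₀, hβ⟩ := h
  exact ⟨c, hc, β₀, fun L _ _ β hβ₀ l Λ Λ' hΛ hΛ' hT => hβ L β hβ₀ l Λ Λ' hΛ hΛ' hT⟩

/-- **(C2a-R) ⇒ the distortion-budget law for heterogeneous stacks at `L ≥ 2`** (same `c`, `β₀`):
an exact transport realised by layers `(Tᵢ, Λᵢ, Λ'ᵢ)` has total distortion `∏ᵢ Λᵢ·Λ'ᵢ ≥ e^{cβ}`.
[ours] -/
theorem exp_le_prod_distortion_of_exactTransportR
    (h : Conjectures.ExactTransportBiLipschitzR d N G ρ) (hd : 2 ≤ d) (hG : Infinite G)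
    (hρ : ∃ g : G, (ρ g).trace.re ≠ N) :
    ∃ c : ℝ, 0 < c ∧ ∃ β₀ : ℝ, ∀ (L : ℕ) [NeZero L], 2 ≤ L → ∀ β : ℝ, β₀ ≤ β →
      ∀ l : List ((GaugeConfig d L G → GaugeConfig d L G) × NNReal × NNReal),
        (∀ t ∈ l, LipschitzWith t.2.1 t.1) → (∀ t ∈ l, AntilipschitzWith t.2.2 t.1) →
        (Measure.pi fun _ : Edge d L => haarProbability G).map (compLayers (l.map Prod.fst)) =
            wilsonMeasure (d := d) (L := L) ρ β →
        Real.exp (c * β) ≤ ((l.map fun t => t.2.1 * t.2.2).prod : NNReal) := by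
  obtain ⟨c, hc, β₀, hβ⟩ := h hd hG hρ
  refine ⟨c, hc, β₀, fun L _ hL β hβ₀ l hΛ hΛ' hT => ?_⟩
  have h1 := hβ L hL β hβ₀ _ _ _ (lipschitzWith_compLayers_prod l hΛ)
    (antilipschitzWith_compLayers_prod l hΛ') hT
  rwa [← NNReal.coe_mul, ← List.prod_map_mul] at h1

/-- **No shallow miracle at `L ≥ 2`**: under (C2a-R) and its guards, at `β ≥ β₀`, `β > 0`, a stack of
layers of per-layer distortion `Λ·Λ' ≤ 1` is never an exact transport. [ours] -/
theorem no_exact_stack_of_distortion_le_one_R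
    (h : Conjectures.ExactTransportBiLipschitzR d N G ρ) (hd : 2 ≤ d) (hG : Infinite G)
    (hρ : ∃ g : G, (ρ g).trace.re ≠ N) :
    ∃ β₀ : ℝ, ∀ (L : ℕ) [NeZero L], 2 ≤ L → ∀ β : ℝ, β₀ ≤ β → 0 < β →
      ∀ (l : List (GaugeConfig d L G → GaugeConfig d L G)) (Λ Λ' : NNReal),
        (∀ T ∈ l, LipschitzWith Λ T) → (∀ T ∈ l, AntilipschitzWith Λ' T) → (Λ : ℝ) * Λ' ≤ 1 →
        (Measure.pi fun _ : Edge d L => haarProbability G).map (compLayers l) ≠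
          wilsonMeasure (d := d) (L := L) ρ β := by
  obtain ⟨c, hc, β₀, hβ⟩ := layerDepthLawR_of_exactTransportR h hd hG hρ
  refine ⟨β₀, fun L _ hL β hβ₀ hβpos l Λ Λ' hΛ hΛ' hΛΛ' hT => ?_⟩
  have h1 := hβ L hL β hβ₀ l Λ Λ' hΛ hΛ' hT
  have h2 : Real.log ((Λ : ℝ) * Λ') ≤ 0 := Real.log_nonpos (by positivity) hΛΛ'
  have h3 : (l.length : ℝ) * Real.log ((Λ : ℝ) * Λ') ≤ 0 :=
    mul_nonpos_of_nonneg_of_nonpos (Nat.cast_nonneg _) h2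
  have h4 : 0 < c * β := mul_pos hc hβpos
  linarith

end LawR

/-! ## §2. Instances: `U(N)`, `SU(N)` (`N ≥ 2`) and — new — `U(1)`, all `d ≥ 2` -/

open scoped Matrix.Norms.Frobenius
open Literature.MathematicalPhysics.QuantumFieldTheory.UnitaryCayley
  Literature.MathematicalPhysics.QuantumLattice

/-- **Repaired layer-depth law for `U(N)`, `N ≥ 2`, `d ≥ 2`** (Hilbert–Schmidt metric), from
`UN.layerDepthLaw`. [ours] -/
theorem UN.layerDepthLawR (d N : ℕ) (hd : 2 ≤ d) (hN : 2 ≤ N) :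
    @LayerDepthLawR d N (𝔾 N) _ Subtype.metricSpace UN.isTopologicalGroup_hs UN.compactSpace_hs _
      UN.borelSpace_hs (unitaryFundamentalRep (Fin N) ℂ) :=
  @layerDepthLawR_of_layerDepthLaw d N (𝔾 N) _ Subtype.metricSpace UN.isTopologicalGroup_hs
    UN.compactSpace_hs _ UN.borelSpace_hs (unitaryFundamentalRep (Fin N) ℂ) (UN.layerDepthLaw d N hd hN)

/-- **Repaired layer-depth law for `SU(N)`, `N ≥ 2`, `d ≥ 2`** (Hilbert–Schmidt metric), from
`SUN.layerDepthLaw`. [ours] -/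
theorem SUN.layerDepthLawR (d N : ℕ) (hd : 2 ≤ d) (hN : 2 ≤ N) :
    @LayerDepthLawR d N (Matrix.specialUnitaryGroup (Fin N) ℂ) _ Subtype.metricSpace
      SUN.isTopologicalGroup_hs SUN.compactSpace_hs _ SUN.borelSpace_hs (fundamentalRep (Fin N)) :=
  @layerDepthLawR_of_layerDepthLaw d N (Matrix.specialUnitaryGroup (Fin N) ℂ) _ Subtype.metricSpace
    SUN.isTopologicalGroup_hs SUN.compactSpace_hs _ SUN.borelSpace_hs (fundamentalRep (Fin N))
    (SUN.layerDepthLaw d N hd hN)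

namespace U1

/-- The defining character of `U(1)` is not constant: `Re tr u1Rep(e^{iπ}) = -1 ≠ 1`. [folklore] -/
theorem exists_re_trace_u1Rep_ne : ∃ g : Circle, (u1Rep g).trace.re ≠ (1 : ℕ) := by
  refine ⟨Circle.exp Real.pi, ?_⟩
  rw [trace_u1Rep_re, re_coe_exp, Real.cos_pi, Nat.cast_one]
  norm_num

/-- **Repaired layer-depth law for `U(1)`** (`Circle`, `u1Rep`, `d ≥ 2`), from row 30's
`U1.exactTransportBiLipschitzR`. [ours] -/
theorem layerDepthLawR (d : ℕ) (hd : 2 ≤ d) : LayerDepthLawR d 1 Circle u1Rep :=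
  layerDepthLawR_of_exactTransportR (exactTransportBiLipschitzR d hd)

/-- **The `U(1)` layer-depth law, guard-free** (OURS): for `d ≥ 2` there are `c > 0` and `β₀` such that
at every volume `L ≥ 2` and coupling `β ≥ β₀`, an EXACT `U(1)` flow (product Haar pushed forward equals
the Wilson measure) that is a stack of `n` layers, each `Λ`-Lipschitz and `Λ'`-antilipschitz for the sup
metric, has `c·β ≤ n·log(Λ·Λ')`: depth of bounded per-layer distortion grows at least linearly in `β`,
uniformly in the volume.  `d = 2` is the STEP-0 system of the cell. [ours] -/
theorem layerDepth (d : ℕ) (hd : 2 ≤ d) :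
    ∃ c : ℝ, 0 < c ∧ ∃ β₀ : ℝ, ∀ (L : ℕ) [NeZero L], 2 ≤ L → ∀ β : ℝ, β₀ ≤ β →
      ∀ (l : List (GaugeConfig d L Circle → GaugeConfig d L Circle)) (Λ Λ' : NNReal),
        (∀ T ∈ l, LipschitzWith Λ T) → (∀ T ∈ l, AntilipschitzWith Λ' T) →
        (Measure.pi fun _ : Edge d L => haarProbability Circle).map (compLayers l) =
            wilsonMeasure (d := d) (L := L) u1Rep β →
        c * β ≤ (l.length : ℝ) * Real.log ((Λ : ℝ) * Λ') :=
  layerDepthLawR d hd hd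
    (Circle.argEquiv.infinite_iff.2 (Set.Ioc.infinite (by linarith [Real.pi_pos]))) exists_re_trace_u1Rep_ne

/-- **`U(1)` distortion budget for heterogeneous stacks, guard-free** (OURS): `∏ᵢ Λᵢ·Λ'ᵢ ≥ e^{cβ}` for
every exact `U(1)` flow at `L ≥ 2`, `β ≥ β₀`, `d ≥ 2`. [ours] -/
theorem exp_le_prod_distortion (d : ℕ) (hd : 2 ≤ d) :
    ∃ c : ℝ, 0 < c ∧ ∃ β₀ : ℝ, ∀ (L : ℕ) [NeZero L], 2 ≤ L → ∀ β : ℝ, β₀ ≤ β →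
      ∀ l : List ((GaugeConfig d L Circle → GaugeConfig d L Circle) × NNReal × NNReal),
        (∀ t ∈ l, LipschitzWith t.2.1 t.1) → (∀ t ∈ l, AntilipschitzWith t.2.2 t.1) →
        (Measure.pi fun _ : Edge d L => haarProbability Circle).map (compLayers (l.map Prod.fst)) =
            wilsonMeasure (d := d) (L := L) u1Rep β →
        Real.exp (c * β) ≤ ((l.map fun t => t.2.1 * t.2.2).prod : NNReal) :=
  exp_le_prod_distortion_of_exactTransportR (exactTransportBiLipschitzR d hd) hd
    (Circle.argEquiv.infinite_iff.2 (Set.Ioc.infinite (by linarith [Real.pi_pos]))) exists_re_trace_u1Rep_ne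

/-- **No shallow exact `U(1)` flow, guard-free** (OURS): for `d ≥ 2` there is `β₀` such that at every
`L ≥ 2`, `β ≥ β₀`, `β > 0`, no stack of layers of per-layer distortion `Λ·Λ' ≤ 1` pushes product Haar
forward to the `U(1)` Wilson measure. [ours] -/
theorem no_exact_stack_of_distortion_le_one (d : ℕ) (hd : 2 ≤ d) :
    ∃ β₀ : ℝ, ∀ (L : ℕ) [NeZero L], 2 ≤ L → ∀ β : ℝ, β₀ ≤ β → 0 < β →
      ∀ (l : List (GaugeConfig d L Circle → GaugeConfig d L Circle)) (Λ Λ' : NNReal),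
        (∀ T ∈ l, LipschitzWith Λ T) → (∀ T ∈ l, AntilipschitzWith Λ' T) → (Λ : ℝ) * Λ' ≤ 1 →
        (Measure.pi fun _ : Edge d L => haarProbability Circle).map (compLayers l) ≠
          wilsonMeasure (d := d) (L := L) u1Rep β :=
  no_exact_stack_of_distortion_le_one_R (exactTransportBiLipschitzR d hd) hd
    (Circle.argEquiv.infinite_iff.2 (Set.Ioc.infinite (by linarith [Real.pi_pos]))) exists_re_trace_u1Rep_ne

end U1

end Summit.Ventures.LatticeQCDFlow.Theory2.Lattice

end
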